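import Summits.QuantumFields.YangMills.Theorems.ParabolicTrajectoryContinuumLimitOnTrajectoryUclVarC

/-!
# Crux `ContinuumLimitOnTrajectory` (stmt-QuantumFields-10522), line `two-orbit-synchronisation` (seat c2):
# the reflected pairing at a fixed step — decomposition and bound (helper of `varBound_of_uuvb`, part D)

Helper file (`--supports stmt-QuantumFields-10522`) of wave-2 worker W2-VAR for the registered stub
`stub_uclOfGap : UCLOfGap`; continues …UclVarA/B/C. At a FIXED step `k` with `a_k ≤ 1`, assuming the `UUVB` inequality at
`k` (constants `s, α ≥ 0, β`): for locus-avoiding `p`-point test functions `F`, `G'` separated in time by a predicate, `G'`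
windowed in `|t| ≤ Tb` with `Tb + a_k ≤ a_k L_k`,
`‖∫ lat P̃ F · lat (P̃∘Θ₀) G' dμ_k‖ ≤ C |F|_{2ps+16p} |G'|_{2ps+16p}` with `C = C(r, p, s, α, β)` (`Var.norm_pairing_le`,
`Var.exists_pairing_bound`) — the DETERMINISTIC part of `VarBound`:
* `Var.lat_smul` — homogeneity of the lattice functional in the test function;
* `Var.pairing_pointwise`, `Var.pairing_integral` — for ANY decomposition `shiftTest q' G' = ∑_{n<N} (n!)⁻¹ D q' n + R q'` of the
  slot-translated test functions, the integrand / the integral as the double plaquette-string sum of the `D`-terms and the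
  `R`-terms (`Arp.lat_curvature_expand`, `Arp.lat_curvature_cfgReflect_expand`; bounded measurable integrands);
* `Var.norm_pairing_le` — the bound, with `D q' n = (∂_{−c(q')})^[n] G'` and `R q'` the Taylor remainder: main terms by
  `Var.norm_main_le` (`UUVB`), remainders by `Var.norm_integral_latVq_mul_le` + `Var.sum_norm_taylorRem_le` with `N = 8p` Taylor orders
  against the `a_k^{−8p}` of the two lattice Riemann sums; `Var.exists_pairing_bound` — its `∃ C` form.
No new definitions, no notation.
-/

set_option autoImplicit false

open scoped SchwartzMap ComplexConjugate
open MeasureTheory Filter Topology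
open Literature.MathematicalPhysics.QuantumFieldTheory Literature.MathematicalPhysics.QuantumLattice
open Literature.MathematicalPhysics.AQFT Literature.Probability.LatticeModels

noncomputable section

namespace Summit.QuantumFields.YangMills.Cruxes.ContinuumLimitOnTrajectory.TwoOrbitSynchronisation

namespace Var

section FixedStep

variable {G : Type} [Group G] [TopologicalSpace G] [IsTopologicalGroup G] [CompactSpace G]
  [MeasurableSpace G] [BorelSpace G]

omit [TopologicalSpace G] [IsTopologicalGroup G] [CompactSpace G] [BorelSpace G] in
/-- Homogeneity of the lattice functional in the test function (real scalars). -/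
theorem lat_smul (sch : SpeciesScheme (YMSpecies G)) (k : ℕ) {p : ℕ} (W : Fin p → LGConfig 4 G → ℝ) (t : ℝ)
    (H : 𝓢((Fin p → EuclideanSpace ℝ (Fin 4)), ℂ)) (U : GaugeConfig 4 (sch.side k) G) :
    Arp.lat sch k W (t • H) U = t • Arp.lat sch k W H U := by
  unfold Arp.lat
  rw [Finset.smul_sum]
  refine Finset.sum_congr rfl fun x _ => ?_
  rw [← smul_mul_assoc]
  rfl

/-- Cleaning up the raw remainder bound: with `a ≤ 1` and `N = 8p` Taylor orders the powers of `a` cancel. -/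
theorem rem_raw_le {a B : ℝ} (ha : 0 < a) (ha1 : a ≤ 1) (hB : 0 ≤ B) (p : ℕ) {x₁ x₂ y₁ y₂ : ℝ} (hx : x₁ ≤ x₂)
    (hy : y₁ ≤ y₂) (hx0 : 0 ≤ x₁) (hy0 : 0 ≤ y₁) :
    ((2 * B) ^ p * ((a ^ (4 * p))⁻¹ * (2 * (a + 1)) ^ (4 * p) * (2 ^ (8 * p) * x₁))) *
        ((2 * B) ^ p * ((a ^ (4 * p))⁻¹ * (2 * (a + 1)) ^ (4 * p) * (4 ^ (8 * p) * (a ^ (8 * p) * y₁)))) ≤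
      (2 * B) ^ p * (2 * B) ^ p * ((2 : ℝ) ^ (8 * p) * 4 ^ (8 * p) * (4 ^ (4 * p) * 4 ^ (4 * p))) * x₂ * y₂ := by
  have hkey : (a ^ (4 * p))⁻¹ * (a ^ (4 * p))⁻¹ * a ^ (8 * p) = 1 := by
    rw [show 8 * p = 4 * p + 4 * p by ring, pow_add]
    have hap : a ^ (4 * p) ≠ 0 := pow_ne_zero _ ha.ne'
    field_simp
  have h4 : (2 * (a + 1)) ^ (4 * p) ≤ 4 ^ (4 * p) := pow_le_pow_left₀ (by positivity) (by linarith) _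
  have h2B : 0 ≤ 2 * B := by positivity
  calc ((2 * B) ^ p * ((a ^ (4 * p))⁻¹ * (2 * (a + 1)) ^ (4 * p) * (2 ^ (8 * p) * x₁))) *
        ((2 * B) ^ p * ((a ^ (4 * p))⁻¹ * (2 * (a + 1)) ^ (4 * p) * (4 ^ (8 * p) * (a ^ (8 * p) * y₁))))
      = (2 * B) ^ p * (2 * B) ^ p * ((2 : ℝ) ^ (8 * p) * 4 ^ (8 * p)) *
          ((2 * (a + 1)) ^ (4 * p) * (2 * (a + 1)) ^ (4 * p)) *
          ((a ^ (4 * p))⁻¹ * (a ^ (4 * p))⁻¹ * a ^ (8 * p)) * (x₁ * y₁) := by ring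
    _ = (2 * B) ^ p * (2 * B) ^ p * ((2 : ℝ) ^ (8 * p) * 4 ^ (8 * p)) *
          ((2 * (a + 1)) ^ (4 * p) * (2 * (a + 1)) ^ (4 * p)) * (x₁ * y₁) := by rw [hkey, mul_one]
    _ ≤ (2 * B) ^ p * (2 * B) ^ p * ((2 : ℝ) ^ (8 * p) * 4 ^ (8 * p)) * (4 ^ (4 * p) * 4 ^ (4 * p)) * (x₂ * y₂) := by
        have h0 : 0 ≤ (2 * B) ^ p * (2 * B) ^ p * ((2 : ℝ) ^ (8 * p) * 4 ^ (8 * p)) := by positivity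
        exact mul_le_mul (mul_le_mul_of_nonneg_left (mul_le_mul h4 h4 (by positivity) (by positivity)) h0)
          (mul_le_mul hx hy hy0 (hx0.trans hx)) (mul_nonneg hx0 hy0) (by positivity)
    _ = _ := by ring

/-! ## The decomposition -/

/-- **The integrand of the reflected pairing as a double plaquette-string sum**, for any decomposition
`shiftTest q' G' = ∑_{n<N} (n!)⁻¹ D q' n + R q'` of the slot-translated test functions of the reflected factor. -/
theorem pairing_pointwise (r : LatticeRep G) (sch : SpeciesScheme (YMSpecies G)) (k : ℕ) {p : ℕ} (N : ℕ)
    (F G' : 𝓢((Fin p → EuclideanSpace ℝ (Fin 4)), ℂ)) {Tb : ℝ} (hGb : ∀ x, G' x ≠ 0 → ∀ i, |x i 0| ≤ Tb)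
    (hT : Tb + sch.a k ≤ sch.a k * sch.L k) (D : (Fin p → PlaqIdx) → ℕ → 𝓢((Fin p → EuclideanSpace ℝ (Fin 4)), ℂ))
    (R : (Fin p → PlaqIdx) → 𝓢((Fin p → EuclideanSpace ℝ (Fin 4)), ℂ))
    (hsplit : ∀ q' : Fin p → PlaqIdx,
      Arp.shiftTest sch k q' G' = (∑ n ∈ Finset.range N, ((n.factorial : ℝ)⁻¹) • D q' n) + R q')
    (U : GaugeConfig 4 (sch.side k) G) :
    Arp.lat sch k (fun _ => Arp.cen r sch k r.curvature.F) F U *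
        Arp.lat sch k (fun _ V => Arp.cen r sch k r.curvature.F (cfgReflect V)) G' U =
      ∑ q : Fin p → PlaqIdx, ∑ q' : Fin p → PlaqIdx,
        ((∑ n ∈ Finset.range N, ((n.factorial : ℝ)⁻¹) •
            (Arp.lat sch k (fun i => Arp.Vq r sch k (q i)) F U * Arp.lat sch k (fun i => Arp.Vq r sch k (q' i)) (D q' n) U)) +
          Arp.lat sch k (fun i => Arp.Vq r sch k (q i)) F U * Arp.lat sch k (fun i => Arp.Vq r sch k (q' i)) (R q') U) := by
  rw [Arp.lat_curvature_expand r sch k F U, Arp.lat_curvature_cfgReflect_expand r sch k G' hGb hT U, Finset.sum_mul_sum]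
  refine Finset.sum_congr rfl fun q _ => Finset.sum_congr rfl fun q' _ => ?_
  rw [hsplit q', Arp.lat_add, mul_add, Arp.lat_sum, Finset.mul_sum]
  congr 1
  refine Finset.sum_congr rfl fun n _ => ?_
  rw [lat_smul, mul_smul_comm]

/-- **The reflected pairing as a double plaquette-string sum of integrals**, for any decomposition as in
`pairing_pointwise` (every integrand is bounded measurable). -/
theorem pairing_integral (r : LatticeRep G) (sch : SpeciesScheme (YMSpecies G)) (k : ℕ) {p : ℕ} (N : ℕ)
    (F G' : 𝓢((Fin p → EuclideanSpace ℝ (Fin 4)), ℂ)) {Tb : ℝ} (hGb : ∀ x, G' x ≠ 0 → ∀ i, |x i 0| ≤ Tb)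
    (hT : Tb + sch.a k ≤ sch.a k * sch.L k) (D : (Fin p → PlaqIdx) → ℕ → 𝓢((Fin p → EuclideanSpace ℝ (Fin 4)), ℂ))
    (R : (Fin p → PlaqIdx) → 𝓢((Fin p → EuclideanSpace ℝ (Fin 4)), ℂ))
    (hsplit : ∀ q' : Fin p → PlaqIdx,
      Arp.shiftTest sch k q' G' = (∑ n ∈ Finset.range N, ((n.factorial : ℝ)⁻¹) • D q' n) + R q') :
    ∫ U, Arp.lat sch k (fun _ => Arp.cen r sch k r.curvature.F) F U *
        Arp.lat sch k (fun _ V => Arp.cen r sch k r.curvature.F (cfgReflect V)) G' U ∂(μW r sch k) =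
      ∑ q : Fin p → PlaqIdx, ∑ q' : Fin p → PlaqIdx,
        ((∑ n ∈ Finset.range N, ((n.factorial : ℝ)⁻¹) •
            ∫ U, Arp.lat sch k (fun i => Arp.Vq r sch k (q i)) F U *
              Arp.lat sch k (fun i => Arp.Vq r sch k (q' i)) (D q' n) U ∂(μW r sch k)) +
          ∫ U, Arp.lat sch k (fun i => Arp.Vq r sch k (q i)) F U *
            Arp.lat sch k (fun i => Arp.Vq r sch k (q' i)) (R q') U ∂(μW r sch k)) := by
  rw [integral_congr_ae (Eventually.of_forall fun U => pairing_pointwise r sch k N F G' hGb hT D R hsplit U)]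
  -- integrability of every summand (bounded measurable functions on a probability space; cf. `Arp.integrable_lat_Vq_mul`)
  have hint : ∀ (q q' : Fin p → PlaqIdx) (X : 𝓢((Fin p → EuclideanSpace ℝ (Fin 4)), ℂ)),
      Integrable (fun U => Arp.lat sch k (fun i => Arp.Vq r sch k (q i)) F U *
        Arp.lat sch k (fun i => Arp.Vq r sch k (q' i)) X U) (μW r sch k) := fun q q' X => by
    have h := Arp.measurable_bdd_mul (measurable_bdd_latVq r sch k q F) (measurable_bdd_latVq r sch k q' X)
    exact Arp.integrable_of_bdd r sch k h.1 h.2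
  have i5 : ∀ (q q' : Fin p → PlaqIdx) (n : ℕ), Integrable (fun U => ((n.factorial : ℝ)⁻¹) •
      (Arp.lat sch k (fun i => Arp.Vq r sch k (q i)) F U * Arp.lat sch k (fun i => Arp.Vq r sch k (q' i)) (D q' n) U))
      (μW r sch k) := fun q q' n => (hint q q' (D q' n)).fun_smul ((n.factorial : ℝ)⁻¹)
  have i4 : ∀ q q' : Fin p → PlaqIdx, Integrable (fun U => Arp.lat sch k (fun i => Arp.Vq r sch k (q i)) F U *
      Arp.lat sch k (fun i => Arp.Vq r sch k (q' i)) (R q') U) (μW r sch k) := fun q q' => hint q q' (R q')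
  have i3 : ∀ q q' : Fin p → PlaqIdx, Integrable (fun U => ∑ n ∈ Finset.range N, ((n.factorial : ℝ)⁻¹) •
      (Arp.lat sch k (fun i => Arp.Vq r sch k (q i)) F U * Arp.lat sch k (fun i => Arp.Vq r sch k (q' i)) (D q' n) U))
      (μW r sch k) := fun q q' => integrable_finsetSum _ fun n _ => i5 q q' n
  have i2 : ∀ q q' : Fin p → PlaqIdx, Integrable (fun U => (∑ n ∈ Finset.range N, ((n.factorial : ℝ)⁻¹) •
      (Arp.lat sch k (fun i => Arp.Vq r sch k (q i)) F U * Arp.lat sch k (fun i => Arp.Vq r sch k (q' i)) (D q' n) U)) +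
      Arp.lat sch k (fun i => Arp.Vq r sch k (q i)) F U * Arp.lat sch k (fun i => Arp.Vq r sch k (q' i)) (R q') U)
      (μW r sch k) := fun q q' => (i3 q q').add (i4 q q')
  rw [integral_finsetSum _ fun q _ => integrable_finsetSum _ fun q' _ => i2 q q']
  refine Finset.sum_congr rfl fun q _ => ?_
  rw [integral_finsetSum _ fun q' _ => i2 q q']
  refine Finset.sum_congr rfl fun q' _ => ?_
  rw [integral_add (i3 q q') (i4 q q'), integral_finsetSum _ fun n _ => i5 q q' n]
  congr 1
  refine Finset.sum_congr rfl fun n _ => ?_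
  rw [integral_smul]

/-! ## The bound -/

/-- **THE FIXED-STEP BOUND.** At a step `k` with `a_k ≤ 1` at which the `UUVB` inequality holds with constants
`s, α ≥ 0, β`, and with `B ≥ 0` a bound on the plaquette species: for locus-avoiding `F`, `G'` separated in time by a
predicate on the time coordinate, `G'` windowed in `|t| ≤ Tb` with `Tb + a_k ≤ a_k L_k`,
`‖∫ lat P̃ F · lat (P̃∘Θ₀) G' dμ_k‖ ≤ C |F|_{2ps+16p} |G'|_{2ps+16p}` with the explicit constant below (Taylor expansion of the
slot-translated test functions to order `N = 8p`; main terms by `norm_main_le`, remainders by counting). -/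
theorem norm_pairing_le (r : LatticeRep G) {B : ℝ} (hB0 : 0 ≤ B) (hB : ∀ (q : PlaqIdx) (V : LGConfig 4 G), |(plaq r q).F V| ≤ B)
    (sch : SpeciesScheme (YMSpecies G)) (k : ℕ) {p s : ℕ} {α β : ℝ} (hα : 0 ≤ α)
    (hU : ∀ (p' : ℕ) (σ : Fin p' → PlaqIdx) (K : 𝓢((Fin p' → EuclideanSpace ℝ (Fin 4)), ℂ)), IsOffDiagonal K →
      ‖canonDistribution r sch k p' (fun i => plaq r (σ i)) K‖ ≤ α * (p'.factorial : ℝ) ^ β * schwartzNorm (p' * s) K)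
    (ha1 : sch.a k ≤ 1) {F G' : 𝓢((Fin p → EuclideanSpace ℝ (Fin 4)), ℂ)} (hF : AvoidsLocus F) (hG : AvoidsLocus G') (P : ℝ → Prop)
    (hFP : tsupport (F : (Fin p → EuclideanSpace ℝ (Fin 4)) → ℂ) ⊆ {x | ∀ j, P (x j 0)})
    (hGP : tsupport (G' : (Fin p → EuclideanSpace ℝ (Fin 4)) → ℂ) ⊆ {y | ∀ j, ¬ P (y j 0)})
    {Tb : ℝ} (hGb : ∀ x, G' x ≠ 0 → ∀ i, |x i 0| ≤ Tb) (hT : Tb + sch.a k ≤ sch.a k * sch.L k) :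
    ‖∫ U, Arp.lat sch k (fun _ => Arp.cen r sch k r.curvature.F) F U *
        Arp.lat sch k (fun _ V => Arp.cen r sch k r.curvature.F (cfgReflect V)) G' U ∂(μW r sch k)‖ ≤
      (Fintype.card (Fin p → PlaqIdx) : ℝ) * ((Fintype.card (Fin p → PlaqIdx) : ℝ) *
        (((8 * p : ℕ) : ℝ) * (α * ((p + p).factorial : ℝ) ^ β * 2 ^ ((p + p) * s + 1)) +
          (2 * B) ^ p * (2 * B) ^ p * ((2 : ℝ) ^ (8 * p) * 4 ^ (8 * p) * (4 ^ (4 * p) * 4 ^ (4 * p))))) *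
        schwartzNorm ((p + p) * s + 16 * p) F * schwartzNorm ((p + p) * s + 16 * p) G' := by
  have ha := sch.a_pos k
  set N := 8 * p with hN
  set M := (p + p) * s with hM
  set sV := (p + p) * s + 16 * p with hsV
  set Amain := α * ((p + p).factorial : ℝ) ^ β * 2 ^ ((p + p) * s + 1) with hA
  set CR := (2 * B) ^ p * (2 * B) ^ p * ((2 : ℝ) ^ (8 * p) * 4 ^ (8 * p) * (4 ^ (4 * p) * 4 ^ (4 * p))) with hCR
  -- the Taylor decomposition of the slot-translated test functions
  set c : (Fin p → PlaqIdx) → (Fin p → EuclideanSpace ℝ (Fin 4)) := fun q' => Arp.shiftVec (Arp.elSlots q') (sch.a k) with hc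
  set D : (Fin p → PlaqIdx) → ℕ → 𝓢((Fin p → EuclideanSpace ℝ (Fin 4)), ℂ) := fun q' n => (LineDeriv.lineDerivOp (-(c q')))^[n] G' with hD
  set R : (Fin p → PlaqIdx) → 𝓢((Fin p → EuclideanSpace ℝ (Fin 4)), ℂ) := fun q' =>
    SchwartzMap.compSubConstCLM ℂ (c q') G' - ∑ n ∈ Finset.range N, ((n.factorial : ℝ)⁻¹) • D q' n with hR
  have hsplit : ∀ q' : Fin p → PlaqIdx,
      Arp.shiftTest sch k q' G' = (∑ n ∈ Finset.range N, ((n.factorial : ℝ)⁻¹) • D q' n) + R q' := fun q' => by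
    rw [hR, add_sub_cancel]
  have hA0 : 0 ≤ Amain := by
    rw [hA]; exact mul_nonneg (mul_nonneg hα (Real.rpow_nonneg (Nat.cast_nonneg _) β)) (by positivity)
  have hF0 := schwartzNorm_nonneg sV F
  have hG0 := schwartzNorm_nonneg sV G'
  have hMs : M ≤ sV := by rw [hM, hsV]; omega
  have hMNs : M + N ≤ sV := by rw [hM, hN, hsV]; omega
  have h8s : 8 * p ≤ sV := by rw [hsV]; omega
  have h16s : 8 * p + N ≤ sV := by rw [hN, hsV]; omega
  rw [pairing_integral r sch k N F G' hGb hT D R hsplit]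
  -- the bound, term by term
  have hcn : ∀ q' : Fin p → PlaqIdx, ‖c q'‖ ≤ sch.a k := fun q' => Arp.norm_shiftVec_le _ ha.le
  have hmain : ∀ (q q' : Fin p → PlaqIdx), ∀ n ∈ Finset.range N,
      ‖((n.factorial : ℝ)⁻¹) • ∫ U, Arp.lat sch k (fun i => Arp.Vq r sch k (q i)) F U *
          Arp.lat sch k (fun i => Arp.Vq r sch k (q' i)) (D q' n) U ∂(μW r sch k)‖ ≤
        Amain * schwartzNorm sV F * schwartzNorm sV G' := by
    intro q q' n hn
    have hnN : n ≤ N := (Finset.mem_range.1 hn).le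
    have hv : ‖-(c q')‖ ≤ 1 := by rw [norm_neg]; exact (hcn q').trans ha1
    have h1 := norm_main_le r sch k hα hU q q' hF hG P hFP hGP hv hnN
    rw [norm_smul, norm_inv, Real.norm_natCast]
    have hfac : ((n.factorial : ℝ))⁻¹ ≤ 1 :=
      inv_le_one_of_one_le₀ (by exact_mod_cast Nat.one_le_iff_ne_zero.2 n.factorial_ne_zero)
    calc ((n.factorial : ℝ))⁻¹ * _ ≤ 1 * (Amain * schwartzNorm M F * schwartzNorm (M + N) G') :=
          mul_le_mul hfac (by rw [hA, hM]; exact h1) (norm_nonneg _) zero_le_one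
      _ ≤ Amain * schwartzNorm sV F * schwartzNorm sV G' := by
          rw [one_mul]
          exact mul_le_mul (mul_le_mul_of_nonneg_left (schwartzNorm_mono hMs F) hA0) (schwartzNorm_mono hMNs G')
            (schwartzNorm_nonneg _ _) (mul_nonneg hA0 hF0)
  have hrem : ∀ q q' : Fin p → PlaqIdx,
      ‖∫ U, Arp.lat sch k (fun i => Arp.Vq r sch k (q i)) F U *
          Arp.lat sch k (fun i => Arp.Vq r sch k (q' i)) (R q') U ∂(μW r sch k)‖ ≤ CR * schwartzNorm sV F * schwartzNorm sV G' := by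
    intro q q'
    have hsum := sum_norm_taylorRem_le ha ha1 (sch.L k) (hcn q') N G'
    refine (norm_integral_latVq_mul_le r hB0 hB sch k q q' F (R q') hsum).trans ?_
    rw [hCR, hN]
    exact rem_raw_le ha ha1 hB0 p (schwartzNorm_mono h8s F) (schwartzNorm_mono h16s G') (schwartzNorm_nonneg _ _)
      (schwartzNorm_nonneg _ _)
  have hterm : ∀ q q' : Fin p → PlaqIdx,
      ‖(∑ n ∈ Finset.range N, ((n.factorial : ℝ)⁻¹) •
            ∫ U, Arp.lat sch k (fun i => Arp.Vq r sch k (q i)) F U *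
              Arp.lat sch k (fun i => Arp.Vq r sch k (q' i)) (D q' n) U ∂(μW r sch k)) +
          ∫ U, Arp.lat sch k (fun i => Arp.Vq r sch k (q i)) F U *
            Arp.lat sch k (fun i => Arp.Vq r sch k (q' i)) (R q') U ∂(μW r sch k)‖ ≤
        ((N : ℝ) * Amain + CR) * schwartzNorm sV F * schwartzNorm sV G' := by
    intro q q'
    refine (norm_add_le _ _).trans ?_
    have h1 := (norm_sum_le _ _).trans (Finset.sum_le_sum (hmain q q'))
    rw [Finset.sum_const, Finset.card_range, nsmul_eq_mul] at h1
    have h2 := hrem q q'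
    calc _ ≤ (N : ℝ) * (Amain * schwartzNorm sV F * schwartzNorm sV G') + CR * schwartzNorm sV F * schwartzNorm sV G' :=
          add_le_add h1 h2
      _ = _ := by ring
  refine (norm_sum_le _ _).trans ((Finset.sum_le_sum fun q _ => (norm_sum_le _ _).trans
    (Finset.sum_le_sum fun q' _ => hterm q q')).trans ?_)
  rw [Finset.sum_const, Finset.sum_const, Finset.card_univ, nsmul_eq_mul, nsmul_eq_mul, hN, hA, hCR]
  ring_nf
  rfl

/-- **The `∃ C` form of the fixed-step bound**: the constant depends on `r, p, s, α, β` only — not on the scheme, the step,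
the test functions or the window. -/
theorem exists_pairing_bound (r : LatticeRep G) (p s : ℕ) {α : ℝ} (β : ℝ) (hα : 0 ≤ α) :
    ∃ C : ℝ, 0 ≤ C ∧ ∀ (sch : SpeciesScheme (YMSpecies G)) (k : ℕ),
      (∀ (p' : ℕ) (σ : Fin p' → PlaqIdx) (K : 𝓢((Fin p' → EuclideanSpace ℝ (Fin 4)), ℂ)), IsOffDiagonal K →
        ‖canonDistribution r sch k p' (fun i => plaq r (σ i)) K‖ ≤ α * (p'.factorial : ℝ) ^ β * schwartzNorm (p' * s) K) →
      sch.a k ≤ 1 → ∀ (F G' : 𝓢((Fin p → EuclideanSpace ℝ (Fin 4)), ℂ)), AvoidsLocus F → AvoidsLocus G' →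
      ∀ (P : ℝ → Prop), tsupport (F : (Fin p → EuclideanSpace ℝ (Fin 4)) → ℂ) ⊆ {x | ∀ j, P (x j 0)} →
      tsupport (G' : (Fin p → EuclideanSpace ℝ (Fin 4)) → ℂ) ⊆ {y | ∀ j, ¬ P (y j 0)} →
      ∀ (Tb : ℝ), (∀ x, G' x ≠ 0 → ∀ i, |x i 0| ≤ Tb) → Tb + sch.a k ≤ sch.a k * sch.L k →
      ‖∫ U, Arp.lat sch k (fun _ => Arp.cen r sch k r.curvature.F) F U *
          Arp.lat sch k (fun _ V => Arp.cen r sch k r.curvature.F (cfgReflect V)) G' U ∂(μW r sch k)‖ ≤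
        C * schwartzNorm ((p + p) * s + 16 * p) F * schwartzNorm ((p + p) * s + 16 * p) G' := by
  obtain ⟨B, hB0, hB⟩ := exists_plaq_bound r
  have h1 : 0 ≤ α * ((p + p).factorial : ℝ) ^ β := mul_nonneg hα (Real.rpow_nonneg (Nat.cast_nonneg _) β)
  refine ⟨(Fintype.card (Fin p → PlaqIdx) : ℝ) * ((Fintype.card (Fin p → PlaqIdx) : ℝ) *
      (((8 * p : ℕ) : ℝ) * (α * ((p + p).factorial : ℝ) ^ β * 2 ^ ((p + p) * s + 1)) +
        (2 * B) ^ p * (2 * B) ^ p * ((2 : ℝ) ^ (8 * p) * 4 ^ (8 * p) * (4 ^ (4 * p) * 4 ^ (4 * p))))),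
    by positivity, ?_⟩
  intro sch k hU ha1 F G' hF hG P hFP hGP Tb hGb hT
  exact norm_pairing_le r hB0 hB sch k hα hU ha1 hF hG P hFP hGP hGb hT

end FixedStep

end Var

/-- **Registered anchor of this file** (closed form of `Var.exists_pairing_bound`, for the gate's `--supports` stub check):
the fixed-step bound of the reflected pairing from the `UUVB` inequality at that step, with a constant depending on
`r, p, s, α, β` only. -/
theorem varD_norm_pairing_le :
    ∀ {G : Type} [Group G] [TopologicalSpace G] [IsTopologicalGroup G] [CompactSpace G] [MeasurableSpace G] [BorelSpace G]
      (r : LatticeRep G) (p s : ℕ) (α β : ℝ), 0 ≤ α → ∃ C : ℝ, 0 ≤ C ∧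
      ∀ (sch : SpeciesScheme (YMSpecies G)) (k : ℕ),
      (∀ (p' : ℕ) (σ : Fin p' → PlaqIdx) (K : 𝓢((Fin p' → EuclideanSpace ℝ (Fin 4)), ℂ)), IsOffDiagonal K →
        ‖canonDistribution r sch k p' (fun i => plaq r (σ i)) K‖ ≤ α * (p'.factorial : ℝ) ^ β * schwartzNorm (p' * s) K) →
      sch.a k ≤ 1 → ∀ (F G' : 𝓢((Fin p → EuclideanSpace ℝ (Fin 4)), ℂ)), AvoidsLocus F → AvoidsLocus G' →
      ∀ (P : ℝ → Prop), tsupport (F : (Fin p → EuclideanSpace ℝ (Fin 4)) → ℂ) ⊆ {x | ∀ j, P (x j 0)} →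
      tsupport (G' : (Fin p → EuclideanSpace ℝ (Fin 4)) → ℂ) ⊆ {y | ∀ j, ¬ P (y j 0)} →
      ∀ (Tb : ℝ), (∀ x, G' x ≠ 0 → ∀ i, |x i 0| ≤ Tb) → Tb + sch.a k ≤ sch.a k * sch.L k →
      ‖∫ U, Arp.lat sch k (fun _ => Arp.cen r sch k r.curvature.F) F U *
          Arp.lat sch k (fun _ V => Arp.cen r sch k r.curvature.F (cfgReflect V)) G' U ∂(μW r sch k)‖ ≤
        C * schwartzNorm ((p + p) * s + 16 * p) F * schwartzNorm ((p + p) * s + 16 * p) G' := by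
  intro G _ _ _ _ _ _ r p s α β hα
  exact Var.exists_pairing_bound r p s β hα

end Summit.QuantumFields.YangMills.Cruxes.ContinuumLimitOnTrajectory.TwoOrbitSynchronisation

end
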